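import Mathlib
import HarnessLib
import Summits.HubbardSuperconductivity.HubbardSuperconductivity.Theorems.KLProgrammeKLRegimeSplitTwoLegSizesMSScaleZeroSlot
import Summits.HubbardSuperconductivity.HubbardSuperconductivity.Theorems.KLProgrammeKLRegimeSplitTwoLegSizesMSFitBaseFits

/-!
# Route `KLProgramme`, crux K3 — ENGINE child (`KLRegimeEngineV16`, `stub_twoLeg_scale0`, clause (E3a-MS-Q)): the BASE fits AT SCALE `0`
# by dilation covariance (k3c3-p1 g4)

Seat hubbard-kl-k3c3-p1 (g4).  Companion of `…TwoLegSizesMSScaleZeroSlot`: k3c3-p3's generic base lemmas `ms_base_fit_zero … four`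
(`…MSFitBaseFits`, valid on `4 ≤ y`) read at scale `n₀ = 0` after the dilation `y := 4^1`, `S := 16·G.S j/4^j`, `S' := 16·Q.S' j/4^j`,
`G_l := 16·Gfr_l`, `μ := msMuZ mu`, `lam := lam/64, lam/256`; the right-hand side is then `twoLegBar G Q U j 0` exactly (`twoLegBar_graded`).

* **`msPieceBaseL_le_scaleZero`** — `∀ j ≤ 4, msPieceBaseL X σ R U 0 Λ₃ Λ₄ j ≤ twoLegBar G Q U j 0` from `0 < U ≤ 1`, `0 ≤ X`,
  `Λ₃ ≤ 64·lam3·Gfr₁U²`, `Λ₄ ≤ 256·lam4·Gfr₁U²`, the scale-0 base profile `σ 0 0 ≤ 16·mu 0·U²`, `σ 0 1 ≤ 4·mu 1·U²`, `σ 0 2 ≤ mu 2·U²`,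
  `σ 0 3 ≤ mu 3·U²/4`, `σ 0 4 ≤ mu 4·U²/16` and the two rescaled base package lines per order.

Proofs only (instantiation + `ring`); nothing about the model.
-/

noncomputable section

namespace Summit.HubbardSuperconductivity.HubbardSuperconductivity.Theorems.KLRegimeSplit

set_option linter.dupNamespace false -- summit = problem name (single-conjunct summit), D-0017

open Real Finset Summit.HubbardSuperconductivity.HubbardSuperconductivity.Theorems.PerturbedFermiCurve

/-! ## §1 The base budget shapes under the dilation -/

/-- The scale-0 order-3 base budget shape sits below the dilated shape. -/
theorem msShapeZ3_base {R : RenConsts} (hR : ∀ j, 0 ≤ R.Gfr j) (U : ℝ) (lam3 : ℝ) :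
    4 / 3 * R.Gfr 3 * U ^ 2 * (4 : ℝ) ^ 0 + 64 * lam3 * R.Gfr 1 * U ^ 2 * (4 : ℝ) ^ 0 + 16 / 3 * R.Gfr 3 * U ^ 2 * (4 : ℝ) ^ 0 ≤
      4 / 3 * (16 * R.Gfr 3) * U ^ 2 * (4 : ℝ) ^ 1 + lam3 * (16 * R.Gfr 1) * U ^ 2 * (4 : ℝ) ^ 1 +
        16 / 3 * (16 * R.Gfr 3) * U ^ 2 * (4 : ℝ) ^ 1 := by
  have h3 := hR 3
  rw [← sub_nonneg]
  have e : 4 / 3 * (16 * R.Gfr 3) * U ^ 2 * (4 : ℝ) ^ 1 + lam3 * (16 * R.Gfr 1) * U ^ 2 * (4 : ℝ) ^ 1 +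
      16 / 3 * (16 * R.Gfr 3) * U ^ 2 * (4 : ℝ) ^ 1 -
      (4 / 3 * R.Gfr 3 * U ^ 2 * (4 : ℝ) ^ 0 + 64 * lam3 * R.Gfr 1 * U ^ 2 * (4 : ℝ) ^ 0 + 16 / 3 * R.Gfr 3 * U ^ 2 * (4 : ℝ) ^ 0) =
      420 * (R.Gfr 3 * U ^ 2) := by ring
  rw [e]
  positivity

/-- The scale-0 order-4 base budget shape sits below the dilated shape. -/
theorem msShapeZ4_base {R : RenConsts} (hR : ∀ j, 0 ≤ R.Gfr j) (U : ℝ) (lam4 : ℝ) :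
    16 / 15 * R.Gfr 4 * U ^ 2 * ((4 : ℝ) ^ 0) ^ 2 + 256 * lam4 * R.Gfr 1 * U ^ 2 * ((4 : ℝ) ^ 0) ^ 2 +
        64 / 15 * R.Gfr 4 * U ^ 2 * ((4 : ℝ) ^ 0) ^ 2 ≤
      16 / 15 * (16 * R.Gfr 4) * U ^ 2 * ((4 : ℝ) ^ 1) ^ 2 + lam4 * (16 * R.Gfr 1) * U ^ 2 * ((4 : ℝ) ^ 1) ^ 2 +
        64 / 15 * (16 * R.Gfr 4) * U ^ 2 * ((4 : ℝ) ^ 1) ^ 2 := by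
  have h4 := hR 4
  rw [← sub_nonneg]
  have e : 16 / 15 * (16 * R.Gfr 4) * U ^ 2 * ((4 : ℝ) ^ 1) ^ 2 + lam4 * (16 * R.Gfr 1) * U ^ 2 * ((4 : ℝ) ^ 1) ^ 2 +
      64 / 15 * (16 * R.Gfr 4) * U ^ 2 * ((4 : ℝ) ^ 1) ^ 2 -
      (16 / 15 * R.Gfr 4 * U ^ 2 * ((4 : ℝ) ^ 0) ^ 2 + 256 * lam4 * R.Gfr 1 * U ^ 2 * ((4 : ℝ) ^ 0) ^ 2 +
        64 / 15 * R.Gfr 4 * U ^ 2 * ((4 : ℝ) ^ 0) ^ 2) =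
      1360 * (R.Gfr 4 * U ^ 2) := by ring
  rw [e]
  positivity

/-! ## §2 The base fits at scale `0`, order by order -/

set_option maxHeartbeats 800000 in
set_option maxRecDepth 8000 in
/-- **(E3a-MS) BASE FIT AT SCALE `0`, order 0**: `msPieceBaseL X σ R U 0 Λ₃ Λ₄ 0 ≤ twoLegBar G Q U 0 0` from the scale-0 base profile and the
RESCALED base package lines `msReqBase0 X (msMuZ mu) 0 ≤ 8·G.S 0/4^0`, `U·msReqBase1 X (msMuZ mu) (msRenZ R) lam3 lam4 0 ≤ 8·G.S 0/4^0`
(dilation covariance: `ms_base_fit_zero` at `y = 4^1`, `S = 16·G.S 0/4^0`, `G = 16·Gfr`). -/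
theorem msPieceBaseL_le_scaleZero_zero {G : GeoConsts} {Q : EngConsts} {R : RenConsts} {X U Λ₃ Λ₄ lam3 lam4 : ℝ}
    {σ : ℕ → ℕ → ℝ} {mu : ℕ → ℝ}
    (hU : 0 < U) (hU1 : U ≤ 1) (hX : 0 ≤ X) (hS' : 0 ≤ Q.S' 0) (hmu : ∀ i, 0 ≤ mu i) (hσ0 : ∀ k i, 0 ≤ σ k i) (hs0 : σ 0 0 ≤ 16 * mu 0 * U ^ 2) (hfit0 : msReqBase0 X (msMuZ mu) 0 ≤ 8 * G.S 0 / (4 : ℝ) ^ 0) (hfit1 : U * msReqBase1 X (msMuZ mu) (msRenZ R) lam3 lam4 0 ≤ 8 * G.S 0 / (4 : ℝ) ^ 0) :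
    msPieceBaseL X σ R U 0 Λ₃ Λ₄ 0 ≤ twoLegBar G Q U 0 0 := by
  have hfit0' := hfit0.trans_eq (show (8 * G.S 0 / (4 : ℝ) ^ 0 : ℝ) = 16 * G.S 0 / 2 by ring)
  have hfit1' := hfit1.trans_eq (show (8 * G.S 0 / (4 : ℝ) ^ 0 : ℝ) = 16 * G.S 0 / 2 by ring)
  have h1 := msSizeBaseO_le_zero (X := X) (σ := σ) (A₃ := msA3L R U 0 0 Λ₃) (A₄ := msA4L R U 0 0 Λ₄)
    (hX := hX)
  have h2 := ms_base_fit_zero (X := X) (U := U) (y := (4 : ℝ) ^ 1) (S := 16 * G.S 0) (S' := 16 * Q.S' 0) (σ0 := σ 0) (μ := msMuZ mu)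
    (hX := hX) (hU := hU) (hU1 := hU1) (hy := four_le_four_pow le_rfl) (hS' := by have := hS'; positivity) (hμ := msMuZ_nonneg hmu) (hσ0 := fun i => hσ0 0 i) (hs0 := hs0.trans (le_of_eq (by simp only [msMuZ]; ring))) (hfit0 := hfit0') (hfit1 := hfit1')
  rw [show msPieceBaseL X σ R U 0 Λ₃ Λ₄ 0 = msSizeBaseO X σ (msA3L R U 0 0 Λ₃) (msA4L R U 0 0 Λ₄) 0 from rfl,
    (twoLegBar_graded G Q hU 0).1]
  exact h1.trans (h2.trans (le_of_eq (by field_simp; ring)))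

set_option maxHeartbeats 800000 in
set_option maxRecDepth 8000 in
/-- **(E3a-MS) BASE FIT AT SCALE `0`, order 1**: `msPieceBaseL X σ R U 0 Λ₃ Λ₄ 1 ≤ twoLegBar G Q U 1 0` from the scale-0 base profile and the
RESCALED base package lines `msReqBase0 X (msMuZ mu) 1 ≤ 8·G.S 1/4^1`, `U·msReqBase1 X (msMuZ mu) (msRenZ R) lam3 lam4 1 ≤ 8·G.S 1/4^1`
(dilation covariance: `ms_base_fit_one` at `y = 4^1`, `S = 16·G.S 1/4^1`, `G = 16·Gfr`). -/
theorem msPieceBaseL_le_scaleZero_one {G : GeoConsts} {Q : EngConsts} {R : RenConsts} {X U Λ₃ Λ₄ lam3 lam4 : ℝ}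
    {σ : ℕ → ℕ → ℝ} {mu : ℕ → ℝ}
    (hU : 0 < U) (hU1 : U ≤ 1) (hX : 0 ≤ X) (hS' : 0 ≤ Q.S' 1) (hmu : ∀ i, 0 ≤ mu i) (hσ0 : ∀ k i, 0 ≤ σ k i) (hs1 : σ 0 1 ≤ 4 * mu 1 * U ^ 2) (hfit0 : msReqBase0 X (msMuZ mu) 1 ≤ 8 * G.S 1 / (4 : ℝ) ^ 1) (hfit1 : U * msReqBase1 X (msMuZ mu) (msRenZ R) lam3 lam4 1 ≤ 8 * G.S 1 / (4 : ℝ) ^ 1) :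
    msPieceBaseL X σ R U 0 Λ₃ Λ₄ 1 ≤ twoLegBar G Q U 1 0 := by
  have hfit0' := hfit0.trans_eq (show (8 * G.S 1 / (4 : ℝ) ^ 1 : ℝ) = 4 * G.S 1 / 2 by ring)
  have hfit1' := hfit1.trans_eq (show (8 * G.S 1 / (4 : ℝ) ^ 1 : ℝ) = 4 * G.S 1 / 2 by ring)
  have h1 := msSizeBaseO_le_one (X := X) (σ := σ) (A₃ := msA3L R U 0 0 Λ₃) (A₄ := msA4L R U 0 0 Λ₄)
    (hX := hX) (hσ := hσ0)
  have h2 := ms_base_fit_one (X := X) (U := U) (y := (4 : ℝ) ^ 1) (S := 4 * G.S 1) (S' := 4 * Q.S' 1) (σ0 := σ 0) (μ := msMuZ mu)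
    (hX := hX) (hU := hU) (hU1 := hU1) (hy := four_le_four_pow le_rfl) (hS' := by have := hS'; positivity) (hμ := msMuZ_nonneg hmu) (hσ0 := fun i => hσ0 0 i) (hs1 := hs1.trans (le_of_eq (by simp only [msMuZ]; ring))) (hfit0 := hfit0') (hfit1 := hfit1')
  rw [show msPieceBaseL X σ R U 0 Λ₃ Λ₄ 1 = msSizeBaseO X σ (msA3L R U 0 0 Λ₃) (msA4L R U 0 0 Λ₄) 1 from rfl,
    (twoLegBar_graded G Q hU 0).2.1]
  exact h1.trans (h2.trans (le_of_eq (by field_simp)))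

set_option maxHeartbeats 800000 in
set_option maxRecDepth 8000 in
/-- **(E3a-MS) BASE FIT AT SCALE `0`, order 2**: `msPieceBaseL X σ R U 0 Λ₃ Λ₄ 2 ≤ twoLegBar G Q U 2 0` from the scale-0 base profile and the
RESCALED base package lines `msReqBase0 X (msMuZ mu) 2 ≤ 8·G.S 2/4^2`, `U·msReqBase1 X (msMuZ mu) (msRenZ R) lam3 lam4 2 ≤ 8·G.S 2/4^2`
(dilation covariance: `ms_base_fit_two` at `y = 4^1`, `S = 16·G.S 2/4^2`, `G = 16·Gfr`). -/
theorem msPieceBaseL_le_scaleZero_two {G : GeoConsts} {Q : EngConsts} {R : RenConsts} {X U Λ₃ Λ₄ lam3 lam4 : ℝ}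
    {σ : ℕ → ℕ → ℝ} {mu : ℕ → ℝ}
    (hU : 0 < U) (hU1 : U ≤ 1) (hX : 0 ≤ X) (hS' : 0 ≤ Q.S' 2) (hmu : ∀ i, 0 ≤ mu i) (hσ0 : ∀ k i, 0 ≤ σ k i) (hs1 : σ 0 1 ≤ 4 * mu 1 * U ^ 2) (hs2 : σ 0 2 ≤ mu 2 * U ^ 2) (hfit0 : msReqBase0 X (msMuZ mu) 2 ≤ 8 * G.S 2 / (4 : ℝ) ^ 2) (hfit1 : U * msReqBase1 X (msMuZ mu) (msRenZ R) lam3 lam4 2 ≤ 8 * G.S 2 / (4 : ℝ) ^ 2) :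
    msPieceBaseL X σ R U 0 Λ₃ Λ₄ 2 ≤ twoLegBar G Q U 2 0 := by
  have hfit0' := hfit0.trans_eq (show (8 * G.S 2 / (4 : ℝ) ^ 2 : ℝ) = G.S 2 / 2 by ring)
  have hfit1' := hfit1.trans_eq (show (8 * G.S 2 / (4 : ℝ) ^ 2 : ℝ) = G.S 2 / 2 by ring)
  have h1 := msSizeBaseO_le_two (X := X) (σ := σ) (A₃ := msA3L R U 0 0 Λ₃) (A₄ := msA4L R U 0 0 Λ₄)
    (hX := hX) (hσ := hσ0)
  have h2 := ms_base_fit_two (X := X) (U := U) (y := (4 : ℝ) ^ 1) (S := G.S 2) (S' := Q.S' 2) (σ0 := σ 0) (μ := msMuZ mu)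
    (hX := hX) (hU := hU) (hU1 := hU1) (hy := four_le_four_pow le_rfl) (hS' := by have := hS'; positivity) (hμ := msMuZ_nonneg hmu) (hσ0 := fun i => hσ0 0 i) (hs1 := hs1.trans (le_of_eq (by simp only [msMuZ]; ring))) (hs2 := hs2.trans (le_of_eq (by simp only [msMuZ]; ring))) (hfit0 := hfit0') (hfit1 := hfit1')
  rw [show msPieceBaseL X σ R U 0 Λ₃ Λ₄ 2 = msSizeBaseO X σ (msA3L R U 0 0 Λ₃) (msA4L R U 0 0 Λ₄) 2 from rfl,
    (twoLegBar_graded G Q hU 0).2.2.1]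
  exact h1.trans (h2.trans (le_of_eq (by field_simp)))

set_option maxHeartbeats 800000 in
set_option maxRecDepth 8000 in
/-- **(E3a-MS) BASE FIT AT SCALE `0`, order 3**: `msPieceBaseL X σ R U 0 Λ₃ Λ₄ 3 ≤ twoLegBar G Q U 3 0` from the scale-0 base profile and the
RESCALED base package lines `msReqBase0 X (msMuZ mu) 3 ≤ 8·G.S 3/4^3`, `U·msReqBase1 X (msMuZ mu) (msRenZ R) lam3 lam4 3 ≤ 8·G.S 3/4^3`
(dilation covariance: `ms_base_fit_three` at `y = 4^1`, `S = 16·G.S 3/4^3`, `G = 16·Gfr`). -/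
theorem msPieceBaseL_le_scaleZero_three {G : GeoConsts} {Q : EngConsts} {R : RenConsts} {X U Λ₃ Λ₄ lam3 lam4 : ℝ}
    {σ : ℕ → ℕ → ℝ} {mu : ℕ → ℝ}
    (hR : ∀ j, 0 ≤ R.Gfr j) (hU : 0 < U) (hU1 : U ≤ 1) (hX : 0 ≤ X) (hlam3 : 0 ≤ lam3) (hS' : 0 ≤ Q.S' 3) (hmu : ∀ i, 0 ≤ mu i) (hΛ₃0 : 0 ≤ Λ₃) (hΛ₃ : Λ₃ ≤ 64 * lam3 * R.Gfr 1 * U ^ 2) (hσ0 : ∀ k i, 0 ≤ σ k i) (hs1 : σ 0 1 ≤ 4 * mu 1 * U ^ 2) (hs2 : σ 0 2 ≤ mu 2 * U ^ 2) (hs3 : σ 0 3 ≤ mu 3 * U ^ 2 / 4) (hfit0 : msReqBase0 X (msMuZ mu) 3 ≤ 8 * G.S 3 / (4 : ℝ) ^ 3) (hfit1 : U * msReqBase1 X (msMuZ mu) (msRenZ R) lam3 lam4 3 ≤ 8 * G.S 3 / (4 : ℝ) ^ 3) :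
    msPieceBaseL X σ R U 0 Λ₃ Λ₄ 3 ≤ twoLegBar G Q U 3 0 := by
  have hfit0' := hfit0.trans_eq (show (8 * G.S 3 / (4 : ℝ) ^ 3 : ℝ) = G.S 3 / 4 / 2 by ring)
  have hfit1' := hfit1.trans_eq (show (8 * G.S 3 / (4 : ℝ) ^ 3 : ℝ) = G.S 3 / 4 / 2 by ring)
  have hΛ₃' : Λ₃ ≤ 64 * lam3 * R.Gfr 1 * U ^ 2 * (4 : ℝ) ^ 0 := by rw [pow_zero, mul_one]; exact hΛ₃
  have h1 := msSizeBaseO_le_three (X := X) (σ := σ) (A₃ := msA3L R U 0 0 Λ₃) (A₄ := msA4L R U 0 0 Λ₄)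
    (hX := hX) (hσ := hσ0) (hA₃ := msA3L_nonneg hR U 0 _ hΛ₃0)
  have h2 := ms_base_fit_three (X := X) (U := U) (y := (4 : ℝ) ^ 1) (S := G.S 3 / 4) (S' := Q.S' 3 / 4) (σ0 := σ 0) (μ := msMuZ mu) (A₃ := msA3L R U 0 0 Λ₃) (G1 := 16 * R.Gfr 1) (G3 := 16 * R.Gfr 3) (lam3 := lam3)
    (hX := hX) (hU := hU) (hU1 := hU1) (hy := four_le_four_pow le_rfl) (hG1 := by have := hR 1; positivity) (hG3 := by have := hR 3; positivity) (hlam3 := hlam3) (hS' := by have := hS'; positivity) (hμ := msMuZ_nonneg hmu) (hA₃0 := msA3L_nonneg hR U 0 _ hΛ₃0) (hA₃ := (msA3L_zero_le_shape hΛ₃').trans (msShapeZ3_base hR U lam3)) (hσ0 := fun i => hσ0 0 i) (hs1 := hs1.trans (le_of_eq (by simp only [msMuZ]; ring))) (hs2 := hs2.trans (le_of_eq (by simp only [msMuZ]; ring))) (hs3 := hs3.trans (le_of_eq (by simp only [msMuZ]; ring))) (hfit0 := hfit0') (hfit1 := hfit1')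
  rw [show msPieceBaseL X σ R U 0 Λ₃ Λ₄ 3 = msSizeBaseO X σ (msA3L R U 0 0 Λ₃) (msA4L R U 0 0 Λ₄) 3 from rfl,
    (twoLegBar_graded G Q hU 0).2.2.2.1]
  exact h1.trans (h2.trans (le_of_eq (by field_simp)))

set_option maxHeartbeats 800000 in
set_option maxRecDepth 8000 in
/-- **(E3a-MS) BASE FIT AT SCALE `0`, order 4**: `msPieceBaseL X σ R U 0 Λ₃ Λ₄ 4 ≤ twoLegBar G Q U 4 0` from the scale-0 base profile and the
RESCALED base package lines `msReqBase0 X (msMuZ mu) 4 ≤ 8·G.S 4/4^4`, `U·msReqBase1 X (msMuZ mu) (msRenZ R) lam3 lam4 4 ≤ 8·G.S 4/4^4`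
(dilation covariance: `ms_base_fit_four` at `y = 4^1`, `S = 16·G.S 4/4^4`, `G = 16·Gfr`). -/
theorem msPieceBaseL_le_scaleZero_four {G : GeoConsts} {Q : EngConsts} {R : RenConsts} {X U Λ₃ Λ₄ lam3 lam4 : ℝ}
    {σ : ℕ → ℕ → ℝ} {mu : ℕ → ℝ}
    (hR : ∀ j, 0 ≤ R.Gfr j) (hU : 0 < U) (hU1 : U ≤ 1) (hX : 0 ≤ X) (hlam3 : 0 ≤ lam3) (hlam4 : 0 ≤ lam4) (hS' : 0 ≤ Q.S' 4) (hmu : ∀ i, 0 ≤ mu i) (hΛ₃0 : 0 ≤ Λ₃) (hΛ₃ : Λ₃ ≤ 64 * lam3 * R.Gfr 1 * U ^ 2) (hΛ₄0 : 0 ≤ Λ₄) (hΛ₄ : Λ₄ ≤ 256 * lam4 * R.Gfr 1 * U ^ 2) (hσ0 : ∀ k i, 0 ≤ σ k i) (hs1 : σ 0 1 ≤ 4 * mu 1 * U ^ 2) (hs2 : σ 0 2 ≤ mu 2 * U ^ 2) (hs3 : σ 0 3 ≤ mu 3 * U ^ 2 / 4) (hs4 : σ 0 4 ≤ mu 4 *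 U ^ 2 / 16) (hfit0 : msReqBase0 X (msMuZ mu) 4 ≤ 8 * G.S 4 / (4 : ℝ) ^ 4) (hfit1 : U * msReqBase1 X (msMuZ mu) (msRenZ R) lam3 lam4 4 ≤ 8 * G.S 4 / (4 : ℝ) ^ 4) :
    msPieceBaseL X σ R U 0 Λ₃ Λ₄ 4 ≤ twoLegBar G Q U 4 0 := by
  have hfit0' := hfit0.trans_eq (show (8 * G.S 4 / (4 : ℝ) ^ 4 : ℝ) = G.S 4 / 16 / 2 by ring)
  have hfit1' := hfit1.trans_eq (show (8 * G.S 4 / (4 : ℝ) ^ 4 : ℝ) = G.S 4 / 16 / 2 by ring)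
  have hΛ₃' : Λ₃ ≤ 64 * lam3 * R.Gfr 1 * U ^ 2 * (4 : ℝ) ^ 0 := by rw [pow_zero, mul_one]; exact hΛ₃
  have hΛ₄' : Λ₄ ≤ 256 * lam4 * R.Gfr 1 * U ^ 2 * ((4 : ℝ) ^ 0) ^ 2 := by rw [pow_zero, one_pow, mul_one]; exact hΛ₄
  have h1 := msSizeBaseO_le_four (X := X) (σ := σ) (A₃ := msA3L R U 0 0 Λ₃) (A₄ := msA4L R U 0 0 Λ₄)
    (hX := hX) (hσ := hσ0) (hA₃ := msA3L_nonneg hR U 0 _ hΛ₃0) (hA₄ := msA4L_nonneg hR U 0 _ hΛ₄0)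
  have h2 := ms_base_fit_four (X := X) (U := U) (y := (4 : ℝ) ^ 1) (S := G.S 4 / 16) (S' := Q.S' 4 / 16) (σ0 := σ 0) (μ := msMuZ mu) (A₃ := msA3L R U 0 0 Λ₃) (G1 := 16 * R.Gfr 1) (G3 := 16 * R.Gfr 3) (lam3 := lam3) (A₄ := msA4L R U 0 0 Λ₄) (G4 := 16 * R.Gfr 4) (lam4 := lam4)
    (hX := hX) (hU := hU) (hU1 := hU1) (hy := four_le_four_pow le_rfl) (hG1 := by have := hR 1; positivity) (hG3 := by have := hR 3; positivity) (hG4 := by have := hR 4; positivity) (hlam3 := hlam3) (hlam4 := hlam4) (hS' := by have := hS'; positivity) (hμ := msMuZ_nonneg hmu) (hA₃0 := msA3L_nonneg hR U 0 _ hΛ₃0) (hA₃ := (msA3L_zero_le_shape hΛ₃').trans (msShapeZ3_base hR U lam3)) (hA₄0 := msA4L_nonneg hR U 0 _ hΛ₄0) (hA₄ := (msA4L_zero_le_shape hΛ₄').trans (msShapeZ4_base hR U lam4)) (hσ0 := fun i => hσ0 0 i) (hs1 := hs1.trans (le_of_eq (by simp only [msMuZ]; ring))) (hs2 := hs2.trans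 (le_of_eq (by simp only [msMuZ]; ring))) (hs3 := hs3.trans (le_of_eq (by simp only [msMuZ]; ring))) (hs4 := hs4.trans (le_of_eq (by simp only [msMuZ]; ring))) (hfit0 := hfit0') (hfit1 := hfit1')
  rw [show msPieceBaseL X σ R U 0 Λ₃ Λ₄ 4 = msSizeBaseO X σ (msA3L R U 0 0 Λ₃) (msA4L R U 0 0 Λ₄) 4 from rfl,
    (twoLegBar_graded G Q hU 0).2.2.2.2]
  exact h1.trans (h2.trans (le_of_eq (by field_simp; ring)))

/-- **(E3a-MS) BASE FITS AT SCALE `0`, all orders `j ≤ 4`** — the literal `hfit_n` input of `twoLegSizesMSTQ_zero_of_pieces_mixed`. -/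
theorem msPieceBaseL_le_scaleZero {G : GeoConsts} {Q : EngConsts} {R : RenConsts} {X U Λ₃ Λ₄ lam3 lam4 : ℝ}
    {σ : ℕ → ℕ → ℝ} {mu : ℕ → ℝ}
    (hR : ∀ j, 0 ≤ R.Gfr j) (hU : 0 < U) (hU1 : U ≤ 1) (hX : 0 ≤ X) (hlam3 : 0 ≤ lam3) (hlam4 : 0 ≤ lam4)
    (hS' : ∀ j, 0 ≤ Q.S' j) (hmu : ∀ i, 0 ≤ mu i)
    (hΛ₃0 : 0 ≤ Λ₃) (hΛ₃ : Λ₃ ≤ 64 * lam3 * R.Gfr 1 * U ^ 2) (hΛ₄0 : 0 ≤ Λ₄) (hΛ₄ : Λ₄ ≤ 256 * lam4 * R.Gfr 1 * U ^ 2)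
    (hσ0 : ∀ k i, 0 ≤ σ k i) (hs0 : σ 0 0 ≤ 16 * mu 0 * U ^ 2) (hs1 : σ 0 1 ≤ 4 * mu 1 * U ^ 2) (hs2 : σ 0 2 ≤ mu 2 * U ^ 2) (hs3 : σ 0 3 ≤ mu 3 * U ^ 2 / 4) (hs4 : σ 0 4 ≤ mu 4 * U ^ 2 / 16)
    (hfit0 : ∀ j ≤ 4, msReqBase0 X (msMuZ mu) j ≤ 8 * G.S j / (4 : ℝ) ^ j)
    (hfit1 : ∀ j ≤ 4, U * msReqBase1 X (msMuZ mu) (msRenZ R) lam3 lam4 j ≤ 8 * G.S j / (4 : ℝ) ^ j) :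
    ∀ j ≤ 4, msPieceBaseL X σ R U 0 Λ₃ Λ₄ j ≤ twoLegBar G Q U j 0 := by
  intro j hj
  interval_cases j
  · exact msPieceBaseL_le_scaleZero_zero hU hU1 hX (hS' 0) hmu hσ0 hs0 (hfit0 0 (by norm_num)) (hfit1 0 (by norm_num))
  · exact msPieceBaseL_le_scaleZero_one hU hU1 hX (hS' 1) hmu hσ0 hs1 (hfit0 1 (by norm_num)) (hfit1 1 (by norm_num))
  · exact msPieceBaseL_le_scaleZero_two hU hU1 hX (hS' 2) hmu hσ0 hs1 hs2 (hfit0 2 (by norm_num)) (hfit1 2 (by norm_num))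
  · exact msPieceBaseL_le_scaleZero_three hR hU hU1 hX hlam3 (hS' 3) hmu hΛ₃0 hΛ₃ hσ0 hs1 hs2 hs3 (hfit0 3 (by norm_num))
      (hfit1 3 (by norm_num))
  · exact msPieceBaseL_le_scaleZero_four hR hU hU1 hX hlam3 hlam4 (hS' 4) hmu hΛ₃0 hΛ₃ hΛ₄0 hΛ₄ hσ0 hs1 hs2 hs3 hs4 (hfit0 4 le_rfl)
      (hfit1 4 le_rfl)

end Summit.HubbardSuperconductivity.HubbardSuperconductivity.Theorems.KLRegimeSplit

end
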